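import Literature.NumberTheory.DiophantineApproximation.PolylogTwoPointHermitePadeExpansion
import Literature.NumberTheory.DiophantineApproximation.PolylogTwoPointHermitePadeSeries
import Literature.NumberTheory.DiophantineApproximation.PolylogTwoPointHermitePadeForms
import Literature.NumberTheory.DiophantineApproximation.PolylogTwoPointHermitePadeBounds
import Literature.NumberTheory.DiophantineApproximation.PolylogTwoPointLeadingRate
import Literature.NumberTheory.DiophantineApproximation.SmallFormsIndependence
import Literature.NumberTheory.DiophantineApproximation.IntegerFormsTransference
import HarnessLib

/-!
# Linear independence of `1, Li_s(1/M), Θ_s(1/M)` (`s ≤ w`) over `ℚ` for `log M ≥ 8 (w+1)³`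

Topic `Literature/NumberTheory/DiophantineApproximation`. For every weight `w ≥ 1` and every
integer `M` with `log M ≥ 8 (w + 1)³`, the `2w + 1` real numbers

  `1`,  `L_s = Li_s(1/M) = ∑_{k≥1} M^{-k}/k^s`,  `T_s = Θ_s(1/M) = ∑_{k≥0} M^{-k-1}/(2k+1)^s`  (`1 ≤ s ≤ w`)

are linearly independent over `ℚ` (`ParityPade.intRelation_trivial`, integer coefficients;
`one_polylog_oddPolylog_linearIndependent`, rational coefficients). With `M = N²` and the parity
bridge `Li_s(±1/N) = 2^{−s} Li_s(1/N²) ± N Θ_s(1/N²)` (`PolylogTwoPointParity.lean`) this is the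
two-point case `α = (1, −1)` of David–Hirata-Kohno–Kawashima 2020, Thm 2.1 (the corollary for
`1, Li_s(1/N), Li_s(−1/N)` is drawn in `PolylogTwoPointsLinearIndependence.lean`); the threshold is
crude (`M₀(w) = e^{8(w+1)³}`; no attempt at optimality).
-- TODO(general form): algebraic points and the thresholds `V > 0` of [DavidHirataKohnoKawashima2020, Thm 2.1].

## Proof (assembled from the sibling files)

The parity kernel `K^{(w)}_n(u) = 4^{wn} (u − wn + 1)_{wn}/(2u+1)_{n+1}^w` is, in `t = 2u`, the
product of `w` bricks with integer residues, so (`PolylogTwoPointHermitePadeExpansion.lean`, over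
`BallRivoal.exists_pf_prod`) it expands as `∑ c_{o,p}/(2u+p+1)^{o+1}` with `d_n^{w−1−o} c_{o,p} ∈ ℤ`
and `∑|c| ≤ w!·2^{w((2w+3)n+1)}`; the form `Λ_n = ∑_u K(u) M^{−u−1}` then satisfies
`2^w Λ_n = ∑_{o<w} a_o L_{o+1} + ∑_{o<w} b_o T_{o+1} + a` (`PolylogTwoPointHermitePadeSeries.lean`)
with `d_n^w a_o, d_n^w b_o, d_n^w a ∈ ℤ` and `|a_o|, |b_o| ≤ (∑|c|) 2^w M^{n/2}`
(`PolylogTwoPointHermitePadeForms.lean`), and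
`4^{wn}(wn)!(2wn)!^w/((2w+1)n+1)!^w · M^{−wn−1} ≤ Λ_n ≤ (4/M)^{wn}`
(`PolylogTwoPointHermitePadeBounds.lean`). With `d_n^w ≤ e^{(w+ε)n}` (prime number theorem) and
`4^{wn}(wn)!(2wn)!^w/((2w+1)n+1)!^w ≥ e^{−(κ_w+ε)n}`, `κ_w = w((2w+1) log(1+1/(2w)) − log 2) ≤ w + 1`
(`PolylogTwoPointLeadingRate.lean`), the INTEGER forms `ℓ_n = d_n^w 2^w Λ_n` in the `2w` numbers
`L_1, …, L_w, T_1, …, T_w` have rates `A₂ = w log M − 2w log 2 − w − ε`,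
`A₁ = w log M + κ_w + ε`, `B = ½ log M + w(2w+3) log 2 + w + ε` — the point of the parity kernel is
the ratio `w : ½` between the smallness and the height. A nontrivial relation would, by the
reduction `relation_trivial_of_small_forms` (`SmallFormsIndependence.lean`) and the
`(2w−1)`-dimensional two-rate transference lemma `no_integer_forms`
(`IntegerFormsTransference.lean`), require `(2w−1) B ≥ A₂` or `(2w−1)(A₁ + B) ≥ 2w A₂`; both fail
as soon as `½ log M > (2w−1)(κ_w + w(2w+3) log 2 + w) + 2w(2w log 2 + w) + O(ε)`, which
`log M ≥ 8(w+1)³` guarantees.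

References: S. David, N. Hirata-Kohno, M. Kawashima, Moscow J. Comb. Number Th. 9 (2020), Thm 2.1;
E. M. Nikišin, Mat. Sb. 109 (1979); M. Hata, J. Math. Pures Appl. 69 (1990);
Yu. V. Nesterenko, Vestnik MGU (1985) (the criterion).
-/

noncomputable section

open Finset Filter Real

namespace Literature.NumberTheory.DiophantineApproximation

namespace ParityPade

open _root_.Filter _root_.Topology
open Literature.NumberTheory.Transcendental

/-- The numerical heart of the threshold `log M ≥ 8(w+1)³`: with `κ ≤ w + 1`, `c ≤ 0.7·w(2w+3)`
and `1.38 ≤ l4 ≤ 1.39` (`l4 = log 4`, bounds written as fractions) the two gap conditions of the reduction/transference lemmas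
hold in dimension `2w − 1` for the rates `A₁ = wL + κ + 2δ`, `A₂ = wL − w·l4 − w − 2δ`,
`B = L/2 + c + w + 2δ`, `δ = 1/8`. [folklore] -/
theorem gap_inequalities_parity {wr L κ cw l4 δ : ℝ} (hwr1 : 1 ≤ wr) (hδ : δ = 1 / 8)
    (hκ0 : 0 ≤ κ) (hκ1 : κ ≤ wr + 1) (hcw0 : 0 ≤ cw) (hcw1 : cw ≤ 7 / 10 * wr * (2 * wr + 3))
    (hl40 : 69 / 50 ≤ l4) (hl41 : l4 ≤ 139 / 100) (hL : 8 * (wr + 1) ^ 3 ≤ L) :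
    0 < wr * L - wr * l4 - wr - 2 * δ ∧
      (2 * wr - 1) * (L / 2 + cw + wr + 2 * δ) < wr * L - wr * l4 - wr - 2 * δ ∧
        (2 * wr - 1) * ((wr * L + κ + 2 * δ) + (L / 2 + cw + wr + 2 * δ)) <
          (2 * wr - 1 + 1) * (wr * L - wr * l4 - wr - 2 * δ) := by
  have hw0 : (0 : ℝ) ≤ 2 * wr - 1 := by linarith
  have hv : (0 : ℝ) ≤ wr - 1 := by linarith
  have h1 := mul_le_mul_of_nonneg_left hκ1 hw0
  have h2 := mul_le_mul_of_nonneg_left hcw1 hw0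
  have h3 := mul_nonneg hw0 hκ0
  have h4 := mul_nonneg hw0 hcw0
  have hL64 : 64 ≤ L := le_trans (by nlinarith) hL
  have hwl4 : wr * l4 ≤ 139 / 100 * wr := by nlinarith
  have hwl4' : 0 ≤ wr * l4 := by nlinarith
  -- `L ≥ 8(wr+1)^3 = 8wr³ + 24wr² + 24wr + 8`
  have hL' : 8 * wr ^ 3 + 24 * wr ^ 2 + 24 * wr + 8 ≤ L := by nlinarith
  have hwr3 : wr ^ 2 ≤ wr ^ 3 := by nlinarith
  have hwr2 : wr ≤ wr ^ 2 := by nlinarith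
  subst hδ
  refine ⟨by nlinarith [hL', hwl4, hwl4', hwr3, hwr2, hL64], ?_, ?_⟩
  · nlinarith [hL', hwl4, hwl4', hwr3, hwr2, hL64, h1, h2, h3, h4, mul_nonneg hv (sq_nonneg wr),
      mul_nonneg hv hv, mul_nonneg hv (by linarith : (0:ℝ) ≤ L - 64),
      mul_nonneg (sq_nonneg wr) (by linarith : (0:ℝ) ≤ L - 64)]
  · nlinarith [hL', hwl4, hwl4', hwr3, hwr2, hL64, h1, h2, h3, h4, mul_nonneg hv (sq_nonneg wr),
      mul_nonneg hv hv, mul_nonneg hv (by linarith : (0:ℝ) ≤ L - 64),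
      mul_nonneg (sq_nonneg wr) (by linarith : (0:ℝ) ≤ L - 64)]

set_option maxHeartbeats 400000 in
/-- **No integer relation among `1, Li_s(1/M), Θ_s(1/M)` (`s ≤ w`)** for `w ≥ 1` and
`log M ≥ 8(w+1)³`: if `a + ∑_{j<w} b_j L_{j+1} + ∑_{j<w} c_j T_{j+1} = 0` with integers `a, b_j, c_j`
(`L_s = DilogPade.polylogSeries s (1/M)`, `T_s = oddPolylogSeries s (1/M)`), then all of them vanish.
The one-point-with-two-shifts form of David–Hirata-Kohno–Kawashima 2020, Thm 2.1 at `α = (1, −1)`.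
[cite: DavidHirataKohnoKawashima2020, Thm 2.1] -/
theorem intRelation_trivial (w : ℕ) (hw : 1 ≤ w) (M : ℕ) (hM : 8 * ((w : ℝ) + 1) ^ 3 ≤ Real.log M)
    (a : ℤ) (b c : Fin w → ℤ)
    (h : (a : ℝ) + ∑ j : Fin w, (b j : ℝ) * DilogPade.polylogSeries ((j : ℕ) + 1) (1 / (M : ℝ)) +
      ∑ j : Fin w, (c j : ℝ) * oddPolylogSeries ((j : ℕ) + 1) (1 / (M : ℝ)) = 0) :
    a = 0 ∧ b = 0 ∧ c = 0 := by
  classical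
  obtain ⟨k, rfl⟩ : ∃ k, w = k + 1 := ⟨w - 1, by omega⟩
  -- `M ≥ 4`, `y = 1/M ∈ (0, 1/2]`
  have hwr : (1 : ℝ) ≤ ((k + 1 : ℕ) : ℝ) := by exact_mod_cast hw
  have hL3 : (64 : ℝ) ≤ Real.log M := by
    have h2 : (2 : ℝ) ≤ ((k + 1 : ℕ) : ℝ) + 1 := by linarith
    calc (64 : ℝ) = 8 * 2 ^ 3 := by norm_num
      _ ≤ 8 * (((k + 1 : ℕ) : ℝ) + 1) ^ 3 := by gcongr
      _ ≤ Real.log M := hM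
  have hM0 : (M : ℝ) ≠ 0 := by
    intro h0; rw [h0, Real.log_zero] at hL3; linarith
  have hMpos : (0 : ℝ) < M := lt_of_le_of_ne (Nat.cast_nonneg M) (Ne.symm hM0)
  have hM4 : (4 : ℝ) ≤ M := by
    have h1 : Real.log M ≤ (M : ℝ) - 1 := Real.log_le_sub_one_of_pos hMpos
    linarith
  have hM2 : 2 ≤ M := by exact_mod_cast (show (2 : ℝ) ≤ M by linarith)
  have hM1 : 1 ≤ M := le_trans (by norm_num) hM2
  have hx0 : (0 : ℝ) < 1 / M := by positivity
  have hx1 : 1 / (M : ℝ) ≤ 1 / 2 := one_div_le_one_div_of_le (by norm_num) (by linarith)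
  have hx1' : 1 / (M : ℝ) < 1 := by linarith
  -- the constants (opaque, with defining equations, for `linarith`)
  obtain ⟨wr, hwrdef⟩ : ∃ wr : ℝ, wr = ((k + 1 : ℕ) : ℝ) := ⟨_, rfl⟩
  obtain ⟨l2, hl2def⟩ : ∃ l2 : ℝ, l2 = Real.log 2 := ⟨_, rfl⟩
  obtain ⟨L, hLdef⟩ : ∃ L : ℝ, L = Real.log M := ⟨_, rfl⟩
  obtain ⟨κ, hκdef⟩ : ∃ κ : ℝ,
      κ = wr * ((2 * wr + 1) * Real.log ((2 * wr + 1) / (2 * wr)) - l2) := ⟨_, rfl⟩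
  obtain ⟨cw, hcwdef⟩ : ∃ cw : ℝ, cw = wr * (2 * wr + 3) * l2 := ⟨_, rfl⟩
  obtain ⟨δ, hδdef⟩ : ∃ δ : ℝ, δ = 1 / 8 := ⟨_, rfl⟩
  have hwr1 : 1 ≤ wr := by rw [hwrdef]; exact hwr
  have hwrk : wr = (k : ℝ) + 1 := by rw [hwrdef]; push_cast; ring
  have hwrpos : 0 < wr := by linarith
  have hδ : (0 : ℝ) < δ := by rw [hδdef]; norm_num
  have hl40 : (69 : ℝ) / 50 ≤ 2 * l2 := by
    rw [hl2def]
    have h1 := Real.log_two_gt_d9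
    norm_num at h1 ⊢
    linarith
  have hl41 : 2 * l2 ≤ (139 : ℝ) / 100 := by
    rw [hl2def]
    have h1 := Real.log_two_lt_d9
    norm_num at h1 ⊢
    linarith
  have hl2pos : 0 < l2 := by linarith
  have hL : 8 * (wr + 1) ^ 3 ≤ L := by rw [hLdef, hwrdef]; exact hM
  -- `0 ≤ κ ≤ wr + 1` from `x/(1+x) ≤ log(1+x) ≤ x` at `x = 1/(2wr)`
  have hratio : (2 * wr + 1) / (2 * wr) = 1 + 1 / (2 * wr) := by field_simp
  have hlog_le : Real.log ((2 * wr + 1) / (2 * wr)) ≤ 1 / (2 * wr) := by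
    have h1 := Real.log_le_sub_one_of_pos (show (0 : ℝ) < (2 * wr + 1) / (2 * wr) by positivity)
    rw [hratio] at h1 ⊢
    linarith
  have hlog_ge : l2 / (2 * wr + 1) ≤ Real.log ((2 * wr + 1) / (2 * wr)) := by
    -- `log 2 ≤ 1 ≤ (2wr+1) log(1 + 1/(2wr))` since `log(1+x) ≥ x/(1+x)`: here `x/(1+x) = 1/(2wr+1)`
    have hpos : (0 : ℝ) < (2 * wr + 1) / (2 * wr) := by positivity
    have h1 : 1 - ((2 * wr + 1) / (2 * wr))⁻¹ ≤ Real.log ((2 * wr + 1) / (2 * wr)) :=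
      Real.one_sub_inv_le_log_of_pos hpos
    have h2 : 1 - ((2 * wr + 1) / (2 * wr))⁻¹ = 1 / (2 * wr + 1) := by
      field_simp
      ring
    rw [h2] at h1
    have h3 : l2 / (2 * wr + 1) ≤ 1 / (2 * wr + 1) :=
      div_le_div_of_nonneg_right (by linarith) (by positivity)
    exact h3.trans h1
  have hκ0 : 0 ≤ κ := by
    rw [hκdef]
    refine mul_nonneg hwrpos.le ?_
    have : (2 * wr + 1) * (l2 / (2 * wr + 1)) = l2 := by field_simp
    nlinarith [mul_le_mul_of_nonneg_left hlog_ge (show (0:ℝ) ≤ 2 * wr + 1 by positivity)]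
  have hκ1 : κ ≤ wr + 1 := by
    rw [hκdef]
    have h1 : (2 * wr + 1) * Real.log ((2 * wr + 1) / (2 * wr)) ≤ (2 * wr + 1) * (1 / (2 * wr)) :=
      mul_le_mul_of_nonneg_left hlog_le (by positivity)
    have h2 : (2 * wr + 1) * (1 / (2 * wr)) = 1 + 1 / (2 * wr) := by field_simp
    have h3 : wr * (1 + 1 / (2 * wr) - l2) = wr + 1 / 2 - wr * l2 := by field_simp
    calc wr * ((2 * wr + 1) * Real.log ((2 * wr + 1) / (2 * wr)) - l2)
        ≤ wr * (1 + 1 / (2 * wr) - l2) := by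
          refine mul_le_mul_of_nonneg_left ?_ hwrpos.le
          linarith
      _ = wr + 1 / 2 - wr * l2 := h3
      _ ≤ wr + 1 := by nlinarith [mul_pos hwrpos hl2pos]
  have hcw0 : 0 ≤ cw := by rw [hcwdef]; positivity
  have hcw1 : cw ≤ 7 / 10 * wr * (2 * wr + 3) := by
    rw [hcwdef]; nlinarith [mul_pos hwrpos (show (0:ℝ) < 2 * wr + 3 by linarith)]
  have hLpos : 0 < L := by
    have := pow_pos (show (0:ℝ) < wr + 1 by linarith) 3
    linarith
  -- powers as exponentials in the opaque constants
  have hxpow : ∀ m : ℕ, (1 / (M : ℝ)) ^ m = Real.exp (-(L * m)) := fun m => by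
    rw [hLdef]; exact DilogPade.one_div_pow_eq_exp hMpos m
  have hMpow : ∀ m : ℕ, (M : ℝ) ^ m = Real.exp (L * m) := fun m => by
    rw [hLdef]; exact DilogPade.pow_eq_exp_log_mul hMpos m
  have h2pow : ∀ m : ℕ, (2 : ℝ) ^ m = Real.exp (l2 * m) := fun m => by
    rw [hl2def]; exact DilogPade.pow_eq_exp_log_mul two_pos m
  have h4pow : ∀ m : ℕ, (4 : ℝ) ^ m = Real.exp (2 * l2 * m) := fun m => by
    rw [show (4 : ℝ) = 2 ^ 2 by norm_num, ← pow_mul, h2pow]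
    congr 1
    push_cast
    ring
  -- the gap inequalities, with `l4 = 2 l2`
  obtain ⟨g0, g1, g2⟩ := gap_inequalities_parity hwr1 hδdef hκ0 hκ1 hcw0 hcw1 hl40 hl41 hL
  have hwl2 : 0 ≤ wr * (2 * l2) := mul_nonneg hwrpos.le (by linarith)
  have gA : wr * L - wr * (2 * l2) - wr - 2 * δ ≤ wr * L + κ + 2 * δ := by
    linarith [hwl2, hκ0, hδ, hwrpos]
  have gB : (0 : ℝ) ≤ L / 2 + cw + wr + 2 * δ := by linarith
  have hkk : (((k + 1) + k : ℕ) : ℝ) = 2 * wr - 1 := by rw [hwrk]; push_cast; ring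
  -- the numbers: `Lv j = L_{j+1}`, `Tv j = T_{j+1}`, `θ = (Lv, Tv)` on `Fin ((k+1)+(k+1))`
  set Lv : Fin (k + 1) → ℝ := fun j => DilogPade.polylogSeries ((j : ℕ) + 1) (1 / (M : ℝ)) with hLv
  set Tv : Fin (k + 1) → ℝ := fun j => oddPolylogSeries ((j : ℕ) + 1) (1 / (M : ℝ)) with hTv
  set θ : Fin ((k + 1) + (k + 1)) → ℝ := Fin.append Lv Tv with hθ
  -- the relation, on `θ`
  set cc : Fin ((k + 1) + (k + 1) + 1) → ℤ := Fin.cons a (Fin.append b c) with hcc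
  have h' : (cc 0 : ℝ) + ∑ j : Fin ((k + 1) + (k + 1)), (cc j.succ : ℝ) * θ j = 0 := by
    have e1 : ∑ j : Fin ((k + 1) + (k + 1)), (cc j.succ : ℝ) * θ j =
        ∑ j : Fin (k + 1), (b j : ℝ) * Lv j + ∑ j : Fin (k + 1), (c j : ℝ) * Tv j := by
      rw [Fin.sum_univ_add]
      simp only [hcc, hθ, Fin.cons_succ, Fin.append_left, Fin.append_right]
    rw [e1]
    simpa [hcc, hLv, hTv, add_assoc] using h
  -- the partial-fraction data of the kernels, and the integer forms
  choose cf hcf using fun n => exists_pf_kernelH (k + 1) n hw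
  have hev : ∀ n (u : ℕ), kernelH (k + 1) n u = BallRivoal.pfEval n (k + 1) (cf n) (2 * u) := by
    intro n u
    refine ((hcf n).1 u fun m _ => ?_).symm
    have : (0 : ℚ) < 2 * (u : ℚ) + m + 1 := by positivity
    exact this.ne'
  have hint : ∀ n, BallRivoal.IsInt (k + 1) (Nat.lcmUpto n) (cf n) := fun n => (hcf n).2.1
  have hl1 : ∀ n, BallRivoal.l1 n (k + 1) (cf n) ≤ ((k + 1).factorial : ℚ) *
      ∏ s ∈ range (k + 1), (2 : ℚ) ^ ((2 * s + 5) * n + 1) := fun n => (hcf n).2.2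
  choose qL hqL using fun n (j : Fin (k + 1)) =>
    isInt_lcmUpto_pow_mul_coefLi (hint n) M (o := (j : ℕ)) j.isLt
  choose qT hqT using fun n (j : Fin (k + 1)) =>
    isInt_lcmUpto_pow_mul_coefTh (hint n) M (o := (j : ℕ)) j.isLt
  choose p hp using fun n => isInt_lcmUpto_pow_mul_constH (hint n) hM1 (w := k + 1)
  set q : ℕ → Fin ((k + 1) + (k + 1)) → ℤ := fun n => Fin.append (qL n) (qT n) with hq
  set D : ℕ → ℝ := fun n => ((Nat.lcmUpto n : ℝ)) ^ (k + 1) with hD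
  have hDpos : ∀ n, 0 < D n := fun n => by
    simp only [hD]; exact pow_pos (by exact_mod_cast Nat.lcmUpto_pos n) _
  have hD1 : ∀ n, 1 ≤ D n := fun n => by
    simp only [hD]; exact one_le_pow₀ (by exact_mod_cast Nat.lcmUpto_pos n)
  have hqLR : ∀ n (j : Fin (k + 1)), (qL n j : ℝ) = D n * ((coefLi n (k + 1) (cf n) M j : ℚ) : ℝ) := by
    intro n j
    have h1 := congrArg (fun t : ℚ => (t : ℝ)) (hqL n j)
    push_cast at h1
    simp only [hD]
    linear_combination (-1 : ℝ) * h1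
  have hqTR : ∀ n (j : Fin (k + 1)), (qT n j : ℝ) = D n * ((coefTh n (k + 1) (cf n) M j : ℚ) : ℝ) := by
    intro n j
    have h1 := congrArg (fun t : ℚ => (t : ℝ)) (hqT n j)
    push_cast at h1
    simp only [hD]
    linear_combination (-1 : ℝ) * h1
  have hpR : ∀ n, (p n : ℝ) = D n * ((constH n (k + 1) (cf n) M : ℚ) : ℝ) := by
    intro n
    have h1 := congrArg (fun t : ℚ => (t : ℝ)) (hp n)
    push_cast at h1
    simp only [hD]
    linear_combination (-1 : ℝ) * h1
  -- the value of the forms: `p_n + ∑ q_{n,i} θ_i = D_n · 2^w Λ_n(1/M)`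
  have hval : ∀ n, (p n : ℝ) + ∑ j, (q n j : ℝ) * θ j =
      D n * ((2 : ℝ) ^ (k + 1) * formH (k + 1) n (1 / (M : ℝ))) := by
    intro n
    have e1 : ∑ j : Fin ((k + 1) + (k + 1)), (q n j : ℝ) * θ j =
        ∑ j : Fin (k + 1), (qL n j : ℝ) * Lv j + ∑ j : Fin (k + 1), (qT n j : ℝ) * Tv j := by
      rw [Fin.sum_univ_add]
      simp only [hq, hθ, Fin.append_left, Fin.append_right]
    rw [e1, formH_eq_of_pfEval hM2 (cf n) (hev n), hpR, mul_add, mul_add, mul_sum, mul_sum,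
      Finset.sum_range, Finset.sum_range]
    have eL : ∑ j : Fin (k + 1), (qL n j : ℝ) * Lv j =
        ∑ j : Fin (k + 1), D n * (((coefLi n (k + 1) (cf n) M j : ℚ) : ℝ) *
          DilogPade.polylogSeries ((j : ℕ) + 1) (1 / (M : ℝ))) := by
      refine Finset.sum_congr rfl fun j _ => ?_
      rw [hqLR n j]
      simp only [hLv]
      ring
    have eT : ∑ j : Fin (k + 1), (qT n j : ℝ) * Tv j =
        ∑ j : Fin (k + 1), D n * (((coefTh n (k + 1) (cf n) M j : ℚ) : ℝ) *
          oddPolylogSeries ((j : ℕ) + 1) (1 / (M : ℝ))) := by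
      refine Finset.sum_congr rfl fun j _ => ?_
      rw [hqTR n j]
      simp only [hTv]
      ring
    rw [eL, eT]
    ring
  have hform_pos : ∀ n, 0 < formH (k + 1) n (1 / (M : ℝ)) := fun n => formH_pos _ n hx0 hx1'
  have hℓpos : ∀ n, 0 < D n * ((2 : ℝ) ^ (k + 1) * formH (k + 1) n (1 / (M : ℝ))) := fun n =>
    mul_pos (hDpos n) (mul_pos (by positivity) (hform_pos n))
  -- the same value identity, indexed by `Fin ((k+1)+k+1)` as in the transference lemma
  have hval' : ∀ n, (p n : ℝ) + ∑ j : Fin ((k + 1) + k + 1), (q n j : ℝ) * θ j =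
      D n * ((2 : ℝ) ^ (k + 1) * formH (k + 1) n (1 / (M : ℝ))) := fun n => hval n
  -- apply the reduction + transference in dimension `(k+1)+k = 2w − 1` with
  -- `A₁ = wL + κ + 2δ`, `A₂ = wL − 2 l2 w − w − 2δ`, `B = L/2 + cw + w + 2δ`
  have key := relation_trivial_of_small_forms (k := (k + 1) + k)
    (fun ξ A₁ A₂ B h1 h2 h3 h4 h5 P Q hl hu hQ => no_integer_forms ξ h1 h2 h3 h4 h5 P Q hl hu hQ)
    θ (A₁ := wr * L + κ + 2 * δ) (A₂ := wr * L - wr * (2 * l2) - wr - 2 * δ)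
    (B := L / 2 + cw + wr + 2 * δ) g0 gA gB (by rw [hkk]; exact g1)
    (by rw [hkk]; exact g2) p q ?_ ?_ ?_ cc h'
  · -- read off `a = 0`, `b = 0`, `c = 0` from `cc = 0`
    have hcc0 : cc = 0 := key
    refine ⟨?_, ?_, ?_⟩
    · have := congrFun hcc0 0
      simpa [hcc] using this
    · funext j
      have := congrFun hcc0 (Fin.castAdd (k + 1) j).succ
      simp only [hcc, Fin.cons_succ, Fin.append_left, Pi.zero_apply] at this
      simpa using this
    · funext j
      have := congrFun hcc0 (Fin.natAdd (k + 1) j).succ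
      simp only [hcc, Fin.cons_succ, Fin.append_right, Pi.zero_apply] at this
      simpa using this
  · -- lower bound `e^{-A₁ n} ≤ ℓ_n`
    have hfac' := eventually_exp_le_kernelH_self (k + 1) hw hδ
    have hκ' : (((k + 1 : ℕ) : ℝ) * ((2 * ((k + 1 : ℕ) : ℝ) + 1) *
        Real.log ((2 * ((k + 1 : ℕ) : ℝ) + 1) / (2 * ((k + 1 : ℕ) : ℝ))) - Real.log 2)) = κ := by
      rw [hκdef, hwrdef, hl2def]
    filter_upwards [hfac', DilogPade.eventually_const_le_mul L hδ] with n hfac hLn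
    rw [hval' n, abs_of_pos (hℓpos n)]
    have hfac2 : Real.exp (-((κ + δ) * n)) ≤
        (4 : ℝ) ^ ((k + 1) * n) * (((k + 1) * n).factorial : ℝ) *
          (((2 * (k + 1) * n).factorial : ℝ) ^ (k + 1)) /
            ((((2 * (k + 1) + 1) * n + 1).factorial : ℝ) ^ (k + 1)) := by
      have := hfac
      rw [hκ'] at this
      convert this using 2
    have h2w : (1 : ℝ) ≤ (2 : ℝ) ^ (k + 1) := one_le_pow₀ (by norm_num)
    calc Real.exp (-((wr * L + κ + 2 * δ) * n))
        ≤ Real.exp (-((κ + δ) * n)) * Real.exp (-(L * ((((k + 1) * n + 1 : ℕ) : ℝ)))) := by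
          rw [← Real.exp_add]
          apply Real.exp_le_exp.2
          rw [hwrk]
          push_cast
          linear_combination hLn
      _ ≤ (4 : ℝ) ^ ((k + 1) * n) * (((k + 1) * n).factorial : ℝ) *
            (((2 * (k + 1) * n).factorial : ℝ) ^ (k + 1)) /
            ((((2 * (k + 1) + 1) * n + 1).factorial : ℝ) ^ (k + 1)) *
            (1 / (M : ℝ)) ^ ((k + 1) * n + 1) := by
          rw [hxpow]
          exact mul_le_mul_of_nonneg_right hfac2 (Real.exp_pos _).le
      _ ≤ formH (k + 1) n (1 / (M : ℝ)) := formH_ge _ n hx0.le hx1'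
      _ ≤ (2 : ℝ) ^ (k + 1) * formH (k + 1) n (1 / (M : ℝ)) :=
          le_mul_of_one_le_left (hform_pos n).le h2w
      _ ≤ D n * ((2 : ℝ) ^ (k + 1) * formH (k + 1) n (1 / (M : ℝ))) :=
          le_mul_of_one_le_left (mul_pos (by positivity) (hform_pos n)).le (hD1 n)
  · -- upper bound `ℓ_n ≤ e^{-A₂ n}`
    have hDev := Literature.NumberTheory.Transcendental.eventually_lcmUpto_mul_pow_le_exp 1 (k + 1) hδ
    filter_upwards [hDev, DilogPade.eventually_const_le_exp_mul ((2 : ℝ) ^ (k + 1)) hδ]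
      with n hDn h2n
    rw [one_mul] at hDn
    push_cast at hDn
    rw [hval' n, abs_of_pos (hℓpos n)]
    have hform_le : formH (k + 1) n (1 / (M : ℝ)) ≤
        (4 : ℝ) ^ ((k + 1) * n) * (1 / (M : ℝ)) ^ ((k + 1) * n) := formH_le _ n hx0.le hx1
    have hDle : D n ≤ Real.exp ((((k : ℝ) + 1) + δ) * n) := by
      simp only [hD]
      have := hDn
      simp only [one_mul] at this
      exact_mod_cast this
    calc D n * ((2 : ℝ) ^ (k + 1) * formH (k + 1) n (1 / (M : ℝ)))
        ≤ Real.exp ((((k : ℝ) + 1) + δ) * n) *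
            (Real.exp (δ * n) * ((4 : ℝ) ^ ((k + 1) * n) * (1 / (M : ℝ)) ^ ((k + 1) * n))) := by
          refine mul_le_mul hDle ?_ (mul_pos (by positivity) (hform_pos n)).le (Real.exp_pos _).le
          exact mul_le_mul h2n hform_le (hform_pos n).le (Real.exp_pos _).le
      _ = Real.exp (-((wr * L - wr * (2 * l2) - wr - 2 * δ) * n)) := by
          rw [h4pow, hxpow, ← Real.exp_add, ← Real.exp_add, ← Real.exp_add]
          congr 1
          rw [hwrk]
          push_cast
          ring
  · -- coefficients `|q_{n,j}| ≤ e^{B n}`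
    have hDev := Literature.NumberTheory.Transcendental.eventually_lcmUpto_mul_pow_le_exp 1 (k + 1) hδ
    filter_upwards [hDev, DilogPade.eventually_const_le_exp_mul
      (((k + 1).factorial : ℝ) * (2 : ℝ) ^ (k + 1) * (2 : ℝ) ^ (k + 1)) hδ] with n hDn hfact j
    rw [one_mul] at hDn
    push_cast at hDn
    have hDle : D n ≤ Real.exp ((((k : ℝ) + 1) + δ) * n) := by
      simp only [hD]
      have := hDn
      simp only [one_mul] at this
      exact_mod_cast this
    -- the `ℓ¹` bound of the partial-fraction data
    have hl1' : BallRivoal.l1 n (k + 1) (cf n) ≤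
        ((k + 1).factorial : ℚ) * (2 : ℚ) ^ ((k + 1) * ((2 * (k + 1) + 3) * n + 1)) :=
      (hl1 n).trans (mul_le_mul_of_nonneg_left (prod_two_pow_le (k + 1) n) (by positivity))
    -- the size of the `j`-th coefficient over `ℚ`, uniformly for both halves
    have hco : ∀ i : Fin ((k + 1) + (k + 1)), |(q n i : ℝ)| ≤ D n *
        (((k + 1).factorial : ℝ) * (2 : ℝ) ^ ((k + 1) * ((2 * (k + 1) + 3) * n + 1)) *
          (2 : ℝ) ^ (k + 1) * (M : ℝ) ^ (n / 2)) := by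
      intro i
      have hbound : ∀ X : ℚ, |X| ≤ BallRivoal.l1 n (k + 1) (cf n) * 2 ^ (k + 1) * (M : ℚ) ^ (n / 2) →
          |((X : ℚ) : ℝ)| ≤ ((k + 1).factorial : ℝ) *
            (2 : ℝ) ^ ((k + 1) * ((2 * (k + 1) + 3) * n + 1)) * (2 : ℝ) ^ (k + 1) * (M : ℝ) ^ (n / 2) := by
        intro X hX
        have h3 : |X| ≤ ((k + 1).factorial : ℚ) * (2 : ℚ) ^ ((k + 1) * ((2 * (k + 1) + 3) * n + 1)) *
            2 ^ (k + 1) * (M : ℚ) ^ (n / 2) :=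
          hX.trans (mul_le_mul_of_nonneg_right (mul_le_mul_of_nonneg_right hl1' (by positivity))
            (by positivity))
        have h4 := (Rat.cast_le (K := ℝ)).2 h3
        push_cast at h4
        exact h4
      induction i using Fin.addCases with
      | left j =>
        have e : q n (Fin.castAdd (k + 1) j) = qL n j := by simp only [hq, Fin.append_left]
        rw [e, hqLR n j, abs_mul, abs_of_pos (hDpos n)]
        exact mul_le_mul_of_nonneg_left (hbound _ (abs_coefLi_le (cf n) hM1 j.isLt)) (hDpos n).le
      | right j =>
        have e : q n (Fin.natAdd (k + 1) j) = qT n j := by simp only [hq, Fin.append_right]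
        rw [e, hqTR n j, abs_mul, abs_of_pos (hDpos n)]
        exact mul_le_mul_of_nonneg_left (hbound _ (abs_coefTh_le (cf n) hM1 j.isLt)) (hDpos n).le
    refine (hco j).trans ?_
    -- `M^{n/2} ≤ exp((L/2) n)` (natural division)
    have hMhalf : (M : ℝ) ^ (n / 2) ≤ Real.exp (L / 2 * n) := by
      rw [hMpow]
      apply Real.exp_le_exp.2
      have h1 : (((n / 2 : ℕ) : ℝ)) ≤ (n : ℝ) / 2 := by
        have : ((n / 2 : ℕ) : ℝ) * 2 ≤ n := by exact_mod_cast Nat.div_mul_le_self n 2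
        linarith
      have := mul_le_mul_of_nonneg_left h1 hLpos.le
      linarith
    calc D n * (((k + 1).factorial : ℝ) * (2 : ℝ) ^ ((k + 1) * ((2 * (k + 1) + 3) * n + 1)) *
          (2 : ℝ) ^ (k + 1) * (M : ℝ) ^ (n / 2))
        = D n * ((((k + 1).factorial : ℝ) * (2 : ℝ) ^ (k + 1) * (2 : ℝ) ^ (k + 1)) *
            ((2 : ℝ) ^ ((k + 1) * ((2 * (k + 1) + 3) * n)) * (M : ℝ) ^ (n / 2))) := by
          rw [show (k + 1) * ((2 * (k + 1) + 3) * n + 1) = (k + 1) * ((2 * (k + 1) + 3) * n) + (k + 1)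
            by ring, pow_add]
          ring
      _ ≤ Real.exp ((((k : ℝ) + 1) + δ) * n) *
            (Real.exp (δ * n) * (Real.exp (l2 * (((k + 1) * ((2 * (k + 1) + 3) * n) : ℕ) : ℝ)) *
              Real.exp (L / 2 * n))) := by
          refine mul_le_mul hDle ?_ (by positivity) (Real.exp_pos _).le
          refine mul_le_mul hfact ?_ (by positivity) (Real.exp_pos _).le
          exact mul_le_mul (le_of_eq (h2pow _)) hMhalf (by positivity) (Real.exp_pos _).le
      _ = Real.exp ((L / 2 + cw + wr + 2 * δ) * n) := by
          rw [← Real.exp_add, ← Real.exp_add, ← Real.exp_add]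
          congr 1
          rw [hcwdef, hwrk]
          push_cast
          ring

end ParityPade

open ParityPade in
/-- **Linear independence of `1, Li_s(1/M), Θ_s(1/M)` (`1 ≤ s ≤ w`) over `ℚ`** for `w ≥ 1` and
`log M ≥ 8(w+1)³`: every rational relation `a + ∑_{j<w} b_j Li_{j+1}(1/M) + ∑_{j<w} c_j Θ_{j+1}(1/M) = 0`
(`Li_s = DilogPade.polylogSeries s`, `Θ_s = oddPolylogSeries s`) is trivial.
[cite: DavidHirataKohnoKawashima2020, Thm 2.1] -/
theorem one_polylog_oddPolylog_linearIndependent (w : ℕ) (hw : 1 ≤ w) (M : ℕ)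
    (hM : 8 * ((w : ℝ) + 1) ^ 3 ≤ Real.log M) (a : ℚ) (b c : Fin w → ℚ)
    (h : (a : ℝ) + ∑ j : Fin w, (b j : ℝ) * DilogPade.polylogSeries ((j : ℕ) + 1) (1 / (M : ℝ)) +
      ∑ j : Fin w, (c j : ℝ) * oddPolylogSeries ((j : ℕ) + 1) (1 / (M : ℝ)) = 0) :
    a = 0 ∧ b = 0 ∧ c = 0 := by
  classical
  -- a common denominator and the integer coefficients
  set d : ℕ := a.den * ((∏ i, (b i).den) * ∏ i, (c i).den) with hd
  have hdpos : 0 < d := Nat.mul_pos a.den_pos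
    (Nat.mul_pos (Finset.prod_pos fun i _ => (b i).den_pos) (Finset.prod_pos fun i _ => (c i).den_pos))
  have hclear : ∀ r : ℚ, r.den ∣ d → ∃ z : ℤ, (d : ℚ) * r = z := by
    intro r hr
    obtain ⟨e, he⟩ := hr
    refine ⟨(e : ℤ) * r.num, ?_⟩
    have h1 : (d : ℚ) = (r.den : ℚ) * e := by exact_mod_cast he
    rw [h1, mul_comm (r.den : ℚ), mul_assoc, Rat.den_mul_eq_num]
    push_cast
    ring
  have hda : a.den ∣ d := Dvd.intro _ rfl
  have hdb : ∀ i, (b i).den ∣ d := fun i =>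
    (Finset.dvd_prod_of_mem (fun i => (b i).den) (mem_univ i)).trans
      ((Dvd.intro _ rfl : (∏ i, (b i).den) ∣ (∏ i, (b i).den) * ∏ i, (c i).den).trans
        (Dvd.intro_left _ rfl))
  have hdc : ∀ i, (c i).den ∣ d := fun i =>
    (Finset.dvd_prod_of_mem (fun i => (c i).den) (mem_univ i)).trans
      ((Dvd.intro_left _ rfl : (∏ i, (c i).den) ∣ (∏ i, (b i).den) * ∏ i, (c i).den).trans
        (Dvd.intro_left _ rfl))
  obtain ⟨a', ha'⟩ := hclear a hda
  choose b' hb' using fun i => hclear (b i) (hdb i)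
  choose c' hc' using fun i => hclear (c i) (hdc i)
  have castR : ∀ (r : ℚ) (z : ℤ), (d : ℚ) * r = z → (z : ℝ) = (d : ℝ) * r := fun r z hz => by
    have := congrArg (fun t : ℚ => (t : ℝ)) hz
    push_cast at this
    linarith
  have hrel : (a' : ℝ) + ∑ j : Fin w, (b' j : ℝ) *
      DilogPade.polylogSeries ((j : ℕ) + 1) (1 / (M : ℝ)) +
      ∑ j : Fin w, (c' j : ℝ) * oddPolylogSeries ((j : ℕ) + 1) (1 / (M : ℝ)) = 0 := by
    have eb : ∑ j : Fin w, (b' j : ℝ) * DilogPade.polylogSeries ((j : ℕ) + 1) (1 / (M : ℝ)) =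
        (d : ℝ) * ∑ j : Fin w, (b j : ℝ) * DilogPade.polylogSeries ((j : ℕ) + 1) (1 / (M : ℝ)) := by
      rw [Finset.mul_sum]
      exact Finset.sum_congr rfl fun j _ => by rw [castR (b j) (b' j) (hb' j)]; ring
    have ec : ∑ j : Fin w, (c' j : ℝ) * oddPolylogSeries ((j : ℕ) + 1) (1 / (M : ℝ)) =
        (d : ℝ) * ∑ j : Fin w, (c j : ℝ) * oddPolylogSeries ((j : ℕ) + 1) (1 / (M : ℝ)) := by
      rw [Finset.mul_sum]
      exact Finset.sum_congr rfl fun j _ => by rw [castR (c j) (c' j) (hc' j)]; ring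
    rw [castR a a' ha', eb, ec]
    have := congrArg (fun t => (d : ℝ) * t) h
    simp only [mul_zero] at this
    linear_combination this
  obtain ⟨h0, h1, h2⟩ := ParityPade.intRelation_trivial w hw M hM a' b' c' hrel
  have hd0 : (d : ℚ) ≠ 0 := by exact_mod_cast hdpos.ne'
  refine ⟨?_, ?_, ?_⟩
  · have e : (d : ℚ) * a = 0 := by rw [ha', h0]; simp
    simpa [hd0] using e
  · funext i
    have e : (d : ℚ) * b i = 0 := by rw [hb' i, congrFun h1 i]; simp
    simpa [hd0] using e
  · funext i
    have e : (d : ℚ) * c i = 0 := by rw [hc' i, congrFun h2 i]; simp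
    simpa [hd0] using e

end Literature.NumberTheory.DiophantineApproximation
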